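import Literature.Analysis.FluidPDE.PassiveScalarForcedTransportEnergy
import HarnessLib

/-!
# Conservative energy balance of SOURCED transport equations with `L¹ₜ Ḣ¹ₓ` (Sobolev) drift

Analysis/FluidPDE proof-support file (everything proved). The tree's
`IsWeakScalarTransportForcedOn.integral_sq_eq_of_lipschitzWith`
(`PassiveScalarForcedTransportEnergy`) proves the conservative balance

  `‖θ(t)‖²_{L²} = ‖θ₀‖²_{L²} + 2 ∫_{(0,t]} ∫ θ f`   for a.e. `t ∈ (0,T)`

for weak solutions `θ ∈ L^∞(0,T; L²(T^d))` of the steadily sourced TRANSPORT equation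
`∂ₜθ + W·∇θ = f` (`κ = 0`) whose drift is LIPSCHITZ in space. Here the same equality is proved
in the genuine DiPerna–Lions setting of a SOBOLEV drift, under the time-integrated hypothesis

  `∫₀ᵀ ‖∇W(t)‖_{L²} dt < ∞`  (spectral `Torus.eGradNormSq`, i.e. `W ∈ L¹(0,T; Ḣ¹(T^d))`),

(`IsWeakScalarTransportForcedOn.integral_sq_eq_of_lintegral_eGradNormSq_rpow_lt_top`): this is
DiPerna–Lions 1989, §II.3, Thm. II.3 (renormalised solutions of transport equations with `W^{1,1}`
drifts conserve `∫ β(θ)`) with the `L²ₓ/L²ₓ` integrability pairing of their Lemma II.1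
(`p = q = 2`), integrated in time as `L¹ₜ × L^∞ₜ`. The class
`Torus.IsWeakScalarTransportForcedOn T 0 W (fun _ => f) θ₀ θ` contains the weak incompressibility
of `W(t)` for a.e. `t`; no continuity of `W` is assumed.

## Proof

Identical to the Lipschitz file except for the commutator: the renormalised mollified identity
`IsWeakScalarTransportForcedOn.ae_integral_comp_molInt_eq` with `κ = 0`, `β = β_M = Calculus.renorm M`
and kernels `kₙ = Torus.kernel εₙ` reads `∫ β_M(Aₙ(t)) = ∫ β_M(θ₀ ⋆ kₙ) + ∫_{(0,t]} ∫ β_M'(Aₙ)(Gₙ + f ⋆ kₙ)`,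
`Aₙ = θ ⋆ kₙ`, where weak incompressibility turns the flux term into the DiPerna–Lions commutator
`rₙ` (`Torus.integral_deriv_comp_mul_flux_eq`); the SOBOLEV commutator estimate of the tree
(`PassiveScalarCommutatorSobolev`, through the translation modulus
`‖W(t)(· + z) - W(t)‖_{L²} ≤ |z| ‖∇W(t)‖_{L²}`, `TorusTranslationEstimate`) gives
`‖rₙ(τ)‖_{L¹ₓ} ≤ c_d ‖θ(τ)‖_{L²} ‖∇W(τ)‖_{L²}` — an INTEGRABLE function of `τ` — and
`‖rₙ(τ)‖_{L¹ₓ} → 0` for a.e. `τ`, whence `∫_{(0,T)} ‖rₙ‖_{L¹ₓ} → 0` by dominated convergence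
(`comm_decay_of_lintegral_eGradNormSq_rpow_lt_top`). Letting `n → ∞` at a.e. `t` and then
`M → ∞` (`PassiveScalarForcedRenormalizedLimits`, `tendsto_integral_renorm_atTop`) gives the
EQUALITY: there is no dissipation term and no semicontinuity step.

## References

* R. J. DiPerna, P.-L. Lions, *Ordinary differential equations, transport theory and Sobolev
  spaces*, Invent. Math. 98 (1989), 511–547, §II.1 Lemma II.1, §II.3 Thm. II.3. [`DiPernaLions1989`]
* L. Ambrosio, G. Crippa, *Continuity equations and ODE flows with non-smooth velocity*,
  Proc. Roy. Soc. Edinburgh 144A (2014), 1191–1244, §4, Thm. 4.6. [`AmbrosioCrippa2014`]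
-/

noncomputable section

open MeasureTheory TopologicalSpace Set Function Filter Topology Metric ContinuousLinearMap
  UnitAddTorus
open scoped ENNReal NNReal Convolution ContDiff InnerProductSpace

namespace Literature.Analysis.FluidPDE

namespace Torus

variable {d : Type*} [Fintype d]

namespace IsWeakScalarTransportForcedOn

/-! ## The Sobolev commutator along a weak solution -/

/-- **Decay of the DiPerna–Lions commutator along a weak solution with `L¹ₜ Ḣ¹ₓ` drift.** For a
weak solution `θ ∈ L^∞(0,T;L²)` of the sourced passive scalar equation whose drift has
`∫₀ᵀ ‖∇W(τ)‖_{L²} dτ < ∞` and mollifiers `kₙ = Torus.kernel εₙ` (`0 < εₙ ≤ 1/4`, `εₙ → 0`), the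
commutators `rₙ(τ, x) = ∫ θ(τ,y) ⟪W(τ,x) - W(τ,y), ∇kₙ(x-y)⟫ dy` satisfy
`‖rₙ(τ)‖_{L¹} ≤ K(τ) := c_d (sup_τ ‖θ(τ)‖_{L²}) ‖∇W(τ)‖_{L²}` for a.e. `τ`, with `K` a.e.-measurable,
`∫_{(0,T)} K < ∞`, `K(τ) < ∞` a.e., and `∫_{(0,T)} ‖rₙ(τ)‖_{L¹} dτ → 0` (the Sobolev commutator
bound `lintegral_enorm_comm_le_eGradNormSq` and convergence `tendsto_lintegral_enorm_comm` at the
a.e. `τ` where `div W(τ) = 0` weakly, dominated convergence in `τ`; DiPerna–Lions 1989,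
Lemma II.1 with `p = q = 2`). [cite: DiPernaLions1989, §II.1 Lemma II.1] -/
theorem comm_decay_of_lintegral_eGradNormSq_rpow_lt_top {T κ : ℝ} {W : ℝ → UnitAddTorus d → EuclideanSpace ℝ d}
    {s : ℝ → UnitAddTorus d → ℝ} {θ₀ : UnitAddTorus d → ℝ} {θ : ℝ → UnitAddTorus d → ℝ}
    (h : IsWeakScalarTransportForcedOn T κ W s θ₀ θ)
    (hG : ∫⁻ t in Set.Ioo 0 T, FunctionSpaces.Torus.eGradNormSq (W t) ^ (1 / 2 : ℝ) < ⊤)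
    {ε : ℕ → ℝ} (hε : ∀ n, 0 < ε n) (hε' : ∀ n, ε n ≤ 1 / 4) (hε0 : Tendsto ε atTop (𝓝 0)) :
    ∃ K : ℝ → ℝ≥0∞, AEMeasurable K (volume.restrict (Set.Ioo 0 T)) ∧
      (∫⁻ τ in Set.Ioo 0 T, K τ) < ⊤ ∧
      (∀ᵐ τ ∂(volume.restrict (Set.Ioo 0 T)), K τ < ⊤) ∧
      (∀ n, ∀ᵐ τ ∂(volume.restrict (Set.Ioo 0 T)),
        ∫⁻ x, ‖∫ y, θ τ y * ⟪W τ x - W τ y,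
          FunctionSpaces.Torus.gradient (FunctionSpaces.Torus.kernel (ε n)) (x - y)⟫_ℝ‖ₑ ≤ K τ) ∧
      Tendsto (fun n => ∫ τ in Set.Ioo 0 T, (∫⁻ x, ‖∫ y, θ τ y * ⟪W τ x - W τ y,
          FunctionSpaces.Torus.gradient (FunctionSpaces.Torus.kernel (ε n)) (x - y)⟫_ℝ‖ₑ).toReal)
        atTop (𝓝 0) := by
  set μT : Measure ℝ := (volume : Measure ℝ).restrict (Set.Ioo 0 T) with hμT
  haveI : IsFiniteMeasure μT := by rw [hμT]; infer_instance
  obtain ⟨C₁, hC₁⟩ := h.exists_eLpNorm_le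
  set kk : ℕ → UnitAddTorus d → ℝ := fun n => FunctionSpaces.Torus.kernel (d := d) (ε n) with hkk
  have hkS : ∀ n, FunctionSpaces.Torus.IsSmooth (kk n) := fun n =>
    FunctionSpaces.Torus.isSmooth_kernel (hε n) (hε' n)
  set ρ : ℕ → ℝ → ℝ≥0∞ := fun n τ =>
    ∫⁻ x, ‖∫ y, θ τ y * ⟪W τ x - W τ y, FunctionSpaces.Torus.gradient (kk n) (x - y)⟫_ℝ‖ₑ with hρ_def
  have hρm : ∀ n, AEMeasurable (ρ n) μT := fun n => h.aemeasurable_lintegral_enorm_comm (hkS n)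
  have hGm : AEMeasurable (fun t => FunctionSpaces.Torus.eGradNormSq (W t)) μT :=
    aemeasurable_eGradNormSq_slice h.aestronglyMeasurable_uncurry_velocity
  -- good slices
  have hGfin : ∀ᵐ τ ∂μT, FunctionSpaces.Torus.eGradNormSq (W τ) < ⊤ := by
    have h1 : ∀ᵐ τ ∂μT, FunctionSpaces.Torus.eGradNormSq (W τ) ^ (1 / 2 : ℝ) < ⊤ :=
      ae_lt_top' (hGm.pow_const _) hG.ne
    filter_upwards [h1] with τ hτ
    by_contra htop
    rw [not_lt, top_le_iff] at htop
    rw [htop, ENNReal.top_rpow_of_pos (by norm_num)] at hτ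
    exact lt_irrefl _ hτ
  have hgood : ∀ᵐ τ ∂μT, (Integrable (θ τ) volume ∧ AEStronglyMeasurable (W τ) volume ∧
      Integrable (fun y => ‖W τ y‖ * θ τ y) volume) ∧ FunctionSpaces.Torus.IsWeaklyDivFree (W τ) ∧
      MemLp (θ τ) 2 volume ∧ eLpNorm (θ τ) 2 volume ≤ C₁ ∧ Integrable (W τ) volume ∧ MemLp (W τ) 2 volume ∧
      FunctionSpaces.Torus.eGradNormSq (W τ) < ⊤ := by
    filter_upwards [h.ae_slice_integrable₁, h.ae_isWeaklyDivFree, h.ae_memLp_two, hC₁, h.ae_integrable_velocity,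
      h.ae_memLp_two_velocity, hGfin] with τ h1 h2 h3 h4 h5 h6 h7
    exact ⟨⟨h1.1, h1.2.1, h1.2.2.1⟩, h2, h3, h4, h5, h6, h7⟩
  -- the dominating function
  set K : ℝ → ℝ≥0∞ := fun τ => (C₁ : ℝ≥0∞) * FunctionSpaces.Torus.eGradNormSq (W τ) ^ (1 / 2 : ℝ) *
    ENNReal.ofReal (FunctionSpaces.Torus.gradProfileMass d) with hK
  have hKm : AEMeasurable K μT := ((hGm.pow_const _).const_mul _).mul_const _
  have hKt : ∫⁻ τ, K τ ∂μT ≠ ⊤ := by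
    rw [hK, lintegral_mul_const'' _ ((hGm.pow_const _).const_mul _), lintegral_const_mul'' _ (hGm.pow_const _)]
    exact ENNReal.mul_ne_top (ENNReal.mul_ne_top ENNReal.coe_ne_top hG.ne) ENNReal.ofReal_ne_top
  have hKfin : ∀ᵐ τ ∂μT, K τ < ⊤ := by
    filter_upwards [hGfin] with τ hτ
    exact ENNReal.mul_lt_top (ENNReal.mul_lt_top ENNReal.coe_lt_top
      (ENNReal.rpow_lt_top_of_nonneg (by norm_num) hτ.ne)) ENNReal.ofReal_lt_top
  have hρle : ∀ n, ∀ᵐ τ ∂μT, ρ n τ ≤ K τ := by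
    intro n
    filter_upwards [hgood] with τ hτ
    obtain ⟨-, -, hθ2, hθC, -, hu2, -⟩ := hτ
    refine (IsWeakScalarTransportOn.lintegral_enorm_comm_le_eGradNormSq hθ2 hu2 (hε n) (hε' n)).trans ?_
    simp only [hK]
    gcongr
  have hρ0 : ∀ᵐ τ ∂μT, Tendsto (fun n => ρ n τ) atTop (𝓝 0) := by
    filter_upwards [hgood] with τ hτ
    obtain ⟨⟨-, -, huθ⟩, hdiv, hθ2, -, hui, hu2, huG⟩ := hτ
    exact tendsto_lintegral_enorm_comm hθ2 hui huθ hdiv (B := FunctionSpaces.Torus.eGradNormSq (W τ) ^ (1 / 2 : ℝ))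
      (ENNReal.rpow_ne_top_of_nonneg (by norm_num) huG.ne) hε hε' hε0 fun n z hz =>
      IsWeakScalarTransportOn.eLpNorm_sub_translate_le_of_gradient_kernel_ne_zero hu2 (hε n) (hε' n) hz
  have hP0 : Tendsto (fun n => ∫⁻ τ, ρ n τ ∂μT) atTop (𝓝 0) := by
    have := tendsto_lintegral_of_dominated_convergence' K hρm hρle hKt
      (hρ0.mono fun τ hτ => by simpa using hτ)
    simpa using this
  refine ⟨K, hKm, hKt.lt_top, hKfin, hρle, ?_⟩
  -- real form of the convergence
  have hfin : ∀ n, ∀ᵐ τ ∂μT, ρ n τ < ⊤ := fun n => by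
    filter_upwards [hρle n, hKfin] with τ h1 h2
    exact h1.trans_lt h2
  have e : ∀ n, ∫ τ, (ρ n τ).toReal ∂μT = (∫⁻ τ, ρ n τ ∂μT).toReal := fun n =>
    integral_toReal (hρm n) (hfin n)
  have h0 : Tendsto (fun n => (∫⁻ τ, ρ n τ ∂μT).toReal) atTop (𝓝 (0 : ℝ≥0∞).toReal) :=
    (ENNReal.tendsto_toReal ENNReal.zero_ne_top).comp hP0
  rw [ENNReal.toReal_zero] at h0
  exact h0.congr fun n => (e n).symm

/-! ## The conservative balance -/

/-- **Conservative energy balance of the sourced transport equation with Sobolev drift**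
(DiPerna–Lions 1989, §II.3, Thm. II.3 with the `L²/L²` pairing of Lemma II.1; any dimension):
for `T > 0`, a smooth steady source `f`, `θ₀ ∈ L²(T^d)`, a drift `W` with
`∫₀ᵀ ‖∇W(t)‖_{L²} dt < ∞` (spectral `Torus.eGradNormSq`) and a weak solution `θ ∈ L^∞(0,T;L²)`
of `∂ₜθ + W·∇θ = f` on `T^d × [0,T)` (the class `IsWeakScalarTransportForcedOn T 0 W (fun _ => f) θ₀ θ`,
which contains the weak incompressibility of `W(t)` for a.e. `t`), for a.e. `t ∈ (0,T)`:
`∫ θ(t,x)² dx = ∫ θ₀² dx + 2 ∫_{(0,t]} ∫ θ(τ,x) f(x) dx dτ` — NO anomalous dissipation is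
possible for a Sobolev drift. [cite: DiPernaLions1989, §II.3 Thm. II.3] -/
theorem integral_sq_eq_of_lintegral_eGradNormSq_rpow_lt_top {T : ℝ} {W : ℝ → UnitAddTorus d → EuclideanSpace ℝ d}
    {f θ₀ : UnitAddTorus d → ℝ} {θ : ℝ → UnitAddTorus d → ℝ} (hf : FunctionSpaces.Torus.IsSmooth f)
    (hθ₀ : MemLp θ₀ 2 volume)
    (hG : ∫⁻ t in Set.Ioo 0 T, FunctionSpaces.Torus.eGradNormSq (W t) ^ (1 / 2 : ℝ) < ⊤)
    (h : IsWeakScalarTransportForcedOn T 0 W (fun _ => f) θ₀ θ) :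
    ∀ᵐ t ∂(volume.restrict (Set.Ioo 0 T)),
      ∫ x, θ t x ^ 2 = (∫ x, θ₀ x ^ 2) + 2 * ∫ τ in Set.Ioc 0 t, ∫ x, θ τ x * f x := by
  set μT : Measure ℝ := (volume : Measure ℝ).restrict (Set.Ioo 0 T) with hμT
  haveI : IsFiniteMeasure μT := by rw [hμT]; infer_instance
  -- radii, kernels, mollification
  obtain ⟨hε, hε', hε0⟩ := molRadius_spec
  set ε : ℕ → ℝ := fun n => 1 / (4 * ((n : ℝ) + 1)) with hε_def
  set kk : ℕ → UnitAddTorus d → ℝ := fun n => FunctionSpaces.Torus.kernel (d := d) (ε n) with hkk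
  have hkS : ∀ n, FunctionSpaces.Torus.IsSmooth (kk n) := fun n =>
    FunctionSpaces.Torus.isSmooth_kernel (hε n) (hε' n)
  have hconv : ∀ (δ : UnitAddTorus d → ℝ) (n : ℕ) (x : UnitAddTorus d), (δ ⋆ kk n) x = ∫ y, δ y * kk n (x - y) :=
    fun δ n x => by simp only [convolution_lsmul, smul_eq_mul]
  have hE0 : ∀ {g : UnitAddTorus d → ℝ}, MemLp g 2 volume →
      Tendsto (fun n => eLpNorm (g ⋆ kk n - g) 2 volume) atTop (𝓝 0) := fun hg =>
    FunctionSpaces.Torus.tendsto_eLpNorm_convolution_sub_self hg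
      (fun n y => FunctionSpaces.Torus.kernel_nonneg (hε n).le y)
      (fun n => FunctionSpaces.Torus.integral_kernel (hε n) (hε' n))
      (fun n => FunctionSpaces.Torus.support_kernel_subset (hε n))
      (fun n => FunctionSpaces.Torus.continuous_kernel (hε n) (hε' n)) hε0
  have hθ₀i : Integrable θ₀ volume := hθ₀.integrable one_le_two
  -- good slices
  have hgood : ∀ᵐ s ∂μT, (Integrable (θ s) volume ∧ AEStronglyMeasurable (W s) volume ∧
      Integrable (fun y => ‖W s y‖ * θ s y) volume) ∧
      FunctionSpaces.Torus.IsWeaklyDivFree (W s) ∧ MemLp (θ s) 2 volume ∧ Integrable (W s) volume := by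
    filter_upwards [h.ae_slice_integrable₁, h.ae_isWeaklyDivFree, h.ae_memLp_two, h.ae_integrable_velocity]
      with s h1 h2 h3 h4
    exact ⟨⟨h1.1, h1.2.1, h1.2.2.1⟩, h2, h3, h4⟩
  -- the commutator
  obtain ⟨Kρ, hKρm, hKρt, hKρfin, hρle, hP0⟩ := h.comm_decay_of_lintegral_eGradNormSq_rpow_lt_top hG hε hε' hε0
  set ρ : ℕ → ℝ → ℝ≥0∞ := fun n s =>
    ∫⁻ x, ‖∫ y, θ s y * ⟪W s x - W s y, FunctionSpaces.Torus.gradient (kk n) (x - y)⟫_ℝ‖ₑ with hρ_def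
  set Pn : ℕ → ℝ := fun n => ∫ s, (ρ n s).toReal ∂μT with hPn_def
  have hρm : ∀ n, AEMeasurable (ρ n) μT := fun n => h.aemeasurable_lintegral_enorm_comm (hkS n)
  have hρt : ∀ n, ∫⁻ s, ρ n s ∂μT ≠ ⊤ := fun n =>
    ne_top_of_le_ne_top hKρt.ne (lintegral_mono_ae (hρle n))
  have hρi : ∀ n, Integrable (fun s => (ρ n s).toReal) μT := fun n =>
    integrable_toReal_of_lintegral_ne_top (hρm n) (hρt n)
  -- the renormalisers `β_M`, `M ∈ ℕ`
  set Cβ : ℕ → ℝ := fun M => 4 * ((Calculus.truncCutoff (M : ℝ)).rIn + 1) with hCβ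
  have hCβ0 : ∀ M, 0 ≤ Cβ M := fun M => by
    have := (Calculus.truncCutoff (M : ℝ)).rIn_pos; simp only [hCβ]; positivity
  have hβ'b : ∀ (M : ℕ) (y : ℝ), |deriv (Calculus.renorm (M : ℝ)) y| ≤ Cβ M := fun M y => by
    rw [Calculus.deriv_renorm]; exact Calculus.abs_renormDeriv_le_const _ y
  -- the terms of the identity
  set LHS : ℕ → ℕ → ℝ → ℝ := fun M n t =>
    ∫ x, Calculus.renorm (M : ℝ) (∫ y, θ t y * kk n (x - y)) with hLHS
  set Dat : ℕ → ℕ → ℝ := fun M n =>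
    ∫ x, Calculus.renorm (M : ℝ) (∫ y, θ₀ y * kk n (x - y)) with hDat
  set Src : ℕ → ℕ → ℝ → ℝ := fun M n t => ∫ τ in Set.Ioc 0 t, ∫ x,
    Calculus.renormDeriv (M : ℝ) (∫ y, θ τ y * kk n (x - y)) * ∫ y, f y * kk n (x - y) with hSrc
  set SrcM : ℕ → ℝ → ℝ := fun M t =>
    ∫ τ in Set.Ioc 0 t, ∫ x, Calculus.renormDeriv (M : ℝ) (θ τ x) * f x with hSrcM
  -- ### the core estimate: `|LHS - Dat - Src| ≤ Cβ_M Pₙ` at a.e. `t`, for each `M`, `n`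
  have hcore : ∀ M n : ℕ, ∀ᵐ t ∂μT, |LHS M n t - Dat M n - Src M n t| ≤ Cβ M * Pn n := by
    intro M n
    have hβtop := Calculus.contDiff_renorm (M : ℝ)
    have hβ : ContDiff ℝ 1 (Calculus.renorm (M : ℝ)) := hβtop.of_le (by simp)
    have hβK := Calculus.lipschitzWith_renorm (M : ℝ)
    have hβ'c : Continuous (deriv (Calculus.renorm (M : ℝ))) := hβ.continuous_deriv le_rfl
    set Φ : ℝ → ℝ := fun s => ∫ x, deriv (Calculus.renorm (M : ℝ)) (∫ y, θ s y * kk n (x - y)) *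
      ((∫ y, θ s y * (-⟪W s y, FunctionSpaces.Torus.gradient (kk n) (x - y)⟫_ℝ +
          0 * FunctionSpaces.Torus.laplacian (kk n) (x - y))) + ∫ y, f y * kk n (x - y)) with hΦ_def
    have hΦi : Integrable Φ μT := (h.integrable_comp_molInt_mul_flux (hkS n) hβ'c (hβ'b M)).integral_prod_left
    set Q : ℝ → ℝ := fun τ =>
      ∫ x, Calculus.renormDeriv (M : ℝ) (∫ y, θ τ y * kk n (x - y)) * ∫ y, f y * kk n (x - y) with hQ_def
    have hQi : Integrable Q μT := h.integrable_integral_renormDeriv_molInt_mul_sourceMol hf (hkS n) (M : ℝ)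
    -- the slice identity `Φ - Q = ∫ β'(Aₙ) rₙ` and the bound `|Φ - Q| ≤ Cβ ρₙ`, a.e. in `s`
    have hslice : ∀ᵐ s ∂μT, |Φ s - Q s| ≤ Cβ M * (ρ n s).toReal := by
      filter_upwards [hgood, hρle n, hKρfin] with s hs hρs hKs
      obtain ⟨⟨hθi, hum, huθ⟩, hdiv, -, hui⟩ := hs
      have hid := integral_deriv_comp_mul_flux_eq hβtop hθi hui huθ hdiv (hkS n) 0
      have hid' : (∫ x, deriv (Calculus.renorm (M : ℝ)) ((θ s ⋆ kk n) x) *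
          ∫ y, θ s y * (-⟪W s y, FunctionSpaces.Torus.gradient (kk n) (x - y)⟫_ℝ +
            0 * FunctionSpaces.Torus.laplacian (kk n) (x - y))) =
          ∫ x, deriv (Calculus.renorm (M : ℝ)) ((θ s ⋆ kk n) x) *
            ∫ y, θ s y * ⟪W s x - W s y, FunctionSpaces.Torus.gradient (kk n) (x - y)⟫_ℝ := by
        rw [hid]; ring
      have hA : FunctionSpaces.Torus.IsSmooth (θ s ⋆ kk n) :=
        FunctionSpaces.Torus.isSmooth_convolution hθi (hkS n)
      have hbc : Continuous fun x => deriv (Calculus.renorm (M : ℝ)) ((θ s ⋆ kk n) x) := hβ'c.comp hA.continuous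
      have hGc := continuous_fluxIntegral hθi hum huθ (hkS n) 0
      have hSc : Continuous fun x => ∫ y, f y * kk n (x - y) := by
        rw [show (fun x => ∫ y, f y * kk n (x - y)) = f ⋆ kk n from funext fun x => (hconv f n x).symm]
        exact FunctionSpaces.Torus.continuous_convolution hf.continuous.integrable_unitAddTorus (hkS n).continuous
      have jG : Integrable (fun x => deriv (Calculus.renorm (M : ℝ)) ((θ s ⋆ kk n) x) *
          ∫ y, θ s y * (-⟪W s y, FunctionSpaces.Torus.gradient (kk n) (x - y)⟫_ℝ +
            0 * FunctionSpaces.Torus.laplacian (kk n) (x - y))) volume := (hbc.mul hGc).integrable_unitAddTorus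
      have jS : Integrable (fun x => deriv (Calculus.renorm (M : ℝ)) ((θ s ⋆ kk n) x) *
          ∫ y, f y * kk n (x - y)) volume :=
        (hbc.mul hSc).integrable_unitAddTorus
      have e1 : Φ s = ∫ x, (deriv (Calculus.renorm (M : ℝ)) ((θ s ⋆ kk n) x) *
          (∫ y, θ s y * (-⟪W s y, FunctionSpaces.Torus.gradient (kk n) (x - y)⟫_ℝ +
            0 * FunctionSpaces.Torus.laplacian (kk n) (x - y))) +
          deriv (Calculus.renorm (M : ℝ)) ((θ s ⋆ kk n) x) * ∫ y, f y * kk n (x - y)) := by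
        simp only [hΦ_def, hconv, mul_add]
      have e3 : Q s = ∫ x, deriv (Calculus.renorm (M : ℝ)) ((θ s ⋆ kk n) x) * ∫ y, f y * kk n (x - y) := by
        simp only [hQ_def, Calculus.deriv_renorm, hconv]
      have e : Φ s - Q s = ∫ x, deriv (Calculus.renorm (M : ℝ)) ((θ s ⋆ kk n) x) *
          ∫ y, θ s y * ⟪W s x - W s y, FunctionSpaces.Torus.gradient (kk n) (x - y)⟫_ℝ := by
        rw [e1, integral_add jG jS, hid', e3, add_sub_cancel_right]
      -- measurability of the commutator slice (no continuity of `W s` is needed)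
      have hKc : Continuous fun p : UnitAddTorus d × UnitAddTorus d =>
          FunctionSpaces.Torus.gradient (kk n) (p.1 - p.2) :=
        (hkS n).gradient.continuous.comp (continuous_fst.sub continuous_snd)
      have hP : AEStronglyMeasurable (Function.uncurry fun (x y : UnitAddTorus d) => θ s y * ⟪W s x - W s y,
          FunctionSpaces.Torus.gradient (kk n) (x - y)⟫_ℝ) ((volume : Measure (UnitAddTorus d)).prod volume) :=
        (hθi.aestronglyMeasurable.comp_snd).mul (((hum.comp_fst).sub (hum.comp_snd)).inner hKc.aestronglyMeasurable)
      have hrm : AEStronglyMeasurable (fun x => ∫ y, θ s y * ⟪W s x - W s y,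
          FunctionSpaces.Torus.gradient (kk n) (x - y)⟫_ℝ) volume := hP.integral_prod_right'
      rw [e]
      exact IsWeakScalarTransportOn.abs_integral_mul_le_mul_toReal_lintegral (fun x => hβ'b M _)
        hrm (hρs.trans_lt hKs)
    -- the good times
    filter_upwards [h.ae_integral_comp_molInt_eq hθ₀i (hkS n) hβ hβK, ae_restrict_mem measurableSet_Ioo]
      with t hid htT
    have hsub : Set.Ioc 0 t ⊆ Set.Ioo 0 T := Set.Ioc_subset_Ioo_right htT.2
    have hle : (volume : Measure ℝ).restrict (Set.Ioc 0 t) ≤ μT := Measure.restrict_mono_set _ hsub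
    have hidΦ : LHS M n t = Dat M n + ∫ s in Set.Ioc 0 t, Φ s := by simpa only using hid
    have hdiff : LHS M n t - Dat M n - Src M n t = ∫ s in Set.Ioc 0 t, (Φ s - Q s) := by
      rw [hidΦ, integral_sub (hΦi.mono_measure hle) (hQi.mono_measure hle)]
      have : Src M n t = ∫ s in Set.Ioc 0 t, Q s := rfl
      rw [this]; ring
    rw [hdiff]
    calc |∫ s in Set.Ioc 0 t, (Φ s - Q s)| ≤ ∫ s in Set.Ioc 0 t, Cβ M * (ρ n s).toReal := by
          rw [← Real.norm_eq_abs]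
          exact norm_integral_le_of_norm_le (((hρi n).mono_measure hle).const_mul _)
            (ae_restrict_of_ae_restrict_of_subset hsub (hslice.mono fun s hs => by rwa [Real.norm_eq_abs]))
      _ = Cβ M * ∫ s in Set.Ioc 0 t, (ρ n s).toReal := MeasureTheory.integral_const_mul _ _
      _ ≤ Cβ M * Pn n := mul_le_mul_of_nonneg_left
          (integral_mono_measure hle (Eventually.of_forall fun s => ENNReal.toReal_nonneg) (hρi n)) (hCβ0 M)
  -- ### assembly at a.e. `t`: `n → ∞` for each `M`, then `M → ∞`
  have hcore' : ∀ᵐ t ∂μT, ∀ M n : ℕ, |LHS M n t - Dat M n - Src M n t| ≤ Cβ M * Pn n :=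
    ae_all_iff.2 fun M => ae_all_iff.2 fun n => hcore M n
  filter_upwards [hcore', hgood, ae_restrict_mem measurableSet_Ioo] with t hct hg htT
  obtain ⟨⟨hθi, -⟩, -, hθ2, -⟩ := hg
  have hM : ∀ M : ℕ, ∫ x, Calculus.renorm (M : ℝ) (θ t x) =
      (∫ x, Calculus.renorm (M : ℝ) (θ₀ x)) + SrcM M t := by
    intro M
    have hβK := Calculus.lipschitzWith_renorm (M : ℝ)
    have h1 : Tendsto (fun n => LHS M n t) atTop (𝓝 (∫ x, Calculus.renorm (M : ℝ) (θ t x))) := by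
      have e : (fun n => LHS M n t) = fun n => ∫ x, Calculus.renorm (M : ℝ) ((θ t ⋆ kk n) x) :=
        funext fun n => by simp only [hLHS, hconv]
      rw [e]
      exact tendsto_integral_comp_of_lipschitzWith hβK hθ2
        (fun n => (FunctionSpaces.Torus.isSmooth_convolution hθi (hkS n)).memLp 2) (hE0 hθ2)
    have h2 : Tendsto (fun n => Dat M n) atTop (𝓝 (∫ x, Calculus.renorm (M : ℝ) (θ₀ x))) := by
      have e : (fun n => Dat M n) = fun n => ∫ x, Calculus.renorm (M : ℝ) ((θ₀ ⋆ kk n) x) :=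
        funext fun n => by simp only [hDat, hconv]
      rw [e]
      exact tendsto_integral_comp_of_lipschitzWith hβK hθ₀
        (fun n => (FunctionSpaces.Torus.isSmooth_convolution hθ₀i (hkS n)).memLp 2) (hE0 hθ₀)
    have h3 : Tendsto (fun n => Src M n t) atTop (𝓝 (SrcM M t)) :=
      h.tendsto_setIntegral_renormDeriv_molInt_mul_sourceMol hf hε hε' hε0 (M : ℝ) htT
    have h4 : Tendsto (fun n => Cβ M * Pn n) atTop (𝓝 0) := by
      have := hP0.const_mul (Cβ M)
      rwa [mul_zero] at this
    have h5 :
        |(∫ x, Calculus.renorm (M : ℝ) (θ t x)) - (∫ x, Calculus.renorm (M : ℝ) (θ₀ x)) - SrcM M t| ≤ 0 :=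
      le_of_tendsto_of_tendsto' ((h1.sub h2).sub h3).abs h4 fun n => hct M n
    linarith [abs_nonpos_iff.1 h5]
  have hL : Tendsto (fun M : ℕ => ∫ x, Calculus.renorm (M : ℝ) (θ t x)) atTop (𝓝 (∫ x, θ t x ^ 2)) :=
    tendsto_integral_renorm_atTop hθ2
  have hR : Tendsto (fun M : ℕ => (∫ x, Calculus.renorm (M : ℝ) (θ₀ x)) + SrcM M t) atTop
      (𝓝 ((∫ x, θ₀ x ^ 2) + 2 * ∫ τ in Set.Ioc 0 t, ∫ x, θ τ x * f x)) :=
    (tendsto_integral_renorm_atTop hθ₀).add (h.tendsto_setIntegral_renormDeriv_mul_source hf htT)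
  exact tendsto_nhds_unique hL (hR.congr fun M => (hM M).symm)

end IsWeakScalarTransportForcedOn

end Torus

end Literature.Analysis.FluidPDE
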